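import Mathlib.MeasureTheory.Function.Jacobian
import Mathlib.MeasureTheory.Constructions.Polish.Basic
import Mathlib.MeasureTheory.Function.AEEqOfIntegral
import Mathlib.MeasureTheory.Integral.Prod
import Literature.NumberTheory.Transcendental.KZCalculus
import Literature.NumberTheory.Transcendental.KZProduct

/-!
# `BetaCancellation` (stmt-KontsevichZagierPeriods-13633), line `dirichlet-companion-to-pi` — stub `stub_fibreSubstitutionAE`

**The measure-theoretic core of the fibre-substitution sector.** Let `p` be a representation of
dimension `d` with `p.value = ∫_K p ≠ 0` (`K = p.domain`), let `q = p ⊗ r` and `q' = p ⊗ r'` be the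
pinned products in the crux's coordinates (catalyst first, `Fin.castAdd n i`; factor last,
`Fin.natAdd d j`), and let `Φ` be ONE change of variables from `q.domain` onto `q'.domain` (the
hypotheses of `KZ.changeOfVariablesRel`: derivative `Φ'` within the domain, injective, image the
target domain, `q.integrand z = q'.integrand (Φ z) · |det Φ' z|`) which is of FIBRE FORM over a
substitution `ψ` of the factor coordinates, `tail (Φ z) = ψ (tail z)`, with `ψ` injective on
`σ = r.domain` and differentiable within `σ`. Then the factor integrands satisfy the rule-(2)
identity `f = (f' ∘ ψ) · |det ψ'|` ALMOST EVERYWHERE on `σ` (`f = r.integrand`, `f' = r'.integrand`).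

Proof. `K` is non-empty (else `p.value = 0`), whence `ψ` maps `σ` into `σ' = r'.domain` (push a
point `(x₀, w)` of `q.domain` through `Φ`). For a measurable `A ⊆ σ` the cylinder
`S_A = K × A = q.domain ∩ {tail ∈ A}` is measurable and `Φ '' S_A = K × ψ(A)` (fibre form, and
injectivity of `ψ` on `σ` for `⊇`). The change-of-variables formula for `Φ` on `S_A`
(`MeasureTheory.integral_image_eq_integral_abs_det_fderiv_smul`) and the Jacobian identity give
`∫_{K × ψ(A)} q' = ∫_{S_A} q`; Fubini (`KZ.appendMeasurableEquiv`, `MeasureTheory.setIntegral_prod_mul`)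
evaluates the two sides as `p.value · ∫_{ψ(A)} f'` and `p.value · ∫_A f` (`ψ(A)` is measurable by
Lusin–Souslin, `MeasurableSet.image_of_continuousOn_injOn`); the change of variables for `ψ` on `A`
turns the first into `p.value · ∫_A |det ψ'| · (f' ∘ ψ)`, and `p.value ≠ 0` cancels. Since
`|det ψ'| · (f' ∘ ψ)` is integrable on `σ`
(`MeasureTheory.integrableOn_image_iff_integrableOn_abs_det_fderiv_smul`, `ψ(σ) ⊆ σ'`), equality of
the integrals over every measurable `A ⊆ σ` gives equality a.e.
(`MeasureTheory.Integrable.ae_eq_of_forall_setIntegral_eq`). No semialgebraic geometry is used beyond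
measurability of the domains. No definitions; sorry-free; axioms ⊆ {propext, Classical.choice, Quot.sound}.

References: M. Kontsevich, D. Zagier, *Periods* (2001), §1.2 rule (2), §4.1 ("Fubini formula").
-/

noncomputable section

-- `Summit.KontsevichZagierPeriods.KontsevichZagierPeriods.…` is the tree's mandated layout (single-conjunct summit).
set_option linter.dupNamespace false

namespace Summit.KontsevichZagierPeriods.KontsevichZagierPeriods.BetaCancellationLine

open MeasureTheory Set
open Literature.NumberTheory.Transcendental
open Literature.NumberTheory.Transcendental.KZ

/-! ### Cylinders `K × B ⊆ ℝ^{d+n}` in the crux's coordinates -/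

/-- Membership in the cylinder `K × B ⊆ ℝ^{d+n}` (image of `K ×ˢ B` under `Fin.append`): the
first `d` coordinates lie in `K` and the last `n` in `B`. [folklore] -/
theorem fibreAE_mem_image_prod {d n : ℕ} {K : Set (Fin d → ℝ)} {B : Set (Fin n → ℝ)}
    {z : Fin (d + n) → ℝ} :
    z ∈ appendMeasurableEquiv d n '' (K ×ˢ B) ↔
      (fun i => z (Fin.castAdd n i)) ∈ K ∧ (fun j => z (Fin.natAdd d j)) ∈ B := by
  rw [MeasurableEquiv.image_eq_preimage_symm, mem_preimage, appendMeasurableEquiv_symm_apply,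
    mem_prod]

/-- The cylinder `K × B` over measurable `K`, `B` is measurable. [folklore] -/
theorem fibreAE_measurableSet_image_prod {d n : ℕ} {K : Set (Fin d → ℝ)} {B : Set (Fin n → ℝ)}
    (hK : MeasurableSet K) (hB : MeasurableSet B) :
    MeasurableSet (appendMeasurableEquiv d n '' (K ×ˢ B)) :=
  (MeasurableEquiv.measurableSet_image _).mpr (hK.prod hB)

/-- **Fubini on a cylinder.** `∫_{K × B} F(head z) · G(tail z) = (∫_K F) · (∫_B G)`, by transport
along the volume-preserving `KZ.appendMeasurableEquiv` and `MeasureTheory.setIntegral_prod_mul`.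
[cite: KontsevichZagier2001, §4.1] -/
theorem fibreAE_setIntegral_image_prod_mul {d n : ℕ} (K : Set (Fin d → ℝ)) (B : Set (Fin n → ℝ))
    (F : (Fin d → ℝ) → ℝ) (G : (Fin n → ℝ) → ℝ) :
    ∫ z in appendMeasurableEquiv d n '' (K ×ˢ B),
        F (fun i => z (Fin.castAdd n i)) * G (fun j => z (Fin.natAdd d j)) =
      (∫ x in K, F x) * ∫ w in B, G w := by
  rw [volume_preserving_appendMeasurableEquiv.setIntegral_image_emb
    (appendMeasurableEquiv d n).measurableEmbedding]
  simp only [appendMeasurableEquiv_apply, Fin.append_left, Fin.append_right]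
  rw [Measure.volume_eq_prod, setIntegral_prod_mul]

/-! ### The stub -/

/-- STUB (measure core, seat c14). For a catalyst `p` of non-zero value and ONE change of variables
`Φ` from the pinned product `p ⊗ r` (`q`) onto the pinned product `p ⊗ r'` (`q'`) which is of FIBRE
FORM over an injective `ψ` on `r.domain` (`tail (Φ z) = ψ (tail z)`), the factor integrands satisfy the
rule-(2) identity `f = (f' ∘ ψ) · |det ψ'|` ALMOST EVERYWHERE on `r.domain`: test the change-of-variables
formula for `Φ` on the cylinders `K × A` (`A ⊆ r.domain` measurable; their images are `K × ψ(A)` by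
injectivity of `ψ`), evaluate both sides by Fubini (`KZ.appendMeasurableEquiv`,
`setIntegral_prod_mul`) as `p.value · ∫_A f` and `p.value · ∫_{ψ A} f' = p.value · ∫_A (f' ∘ ψ)|det ψ'|`
(change of variables for `ψ` on `A`), cancel `p.value ≠ 0`, and conclude by
`Integrable.ae_eq_of_forall_setIntegral_eq`. [cite: KontsevichZagier2001, §1.2 rule (2)] -/
theorem stub_fibreSubstitutionAE {d n : ℕ} (p : IntegralRep d) (hp : p.value ≠ 0)
    (r r' : IntegralRep n) (q q' : IntegralRep (d + n))
    (hq : q.domain = {z | (fun i => z (Fin.castAdd n i)) ∈ p.domain ∧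
      (fun j => z (Fin.natAdd d j)) ∈ r.domain})
    (hqi : Set.EqOn q.integrand (fun z => p.integrand (fun i => z (Fin.castAdd n i)) *
      r.integrand (fun j => z (Fin.natAdd d j))) q.domain)
    (hq' : q'.domain = {z | (fun i => z (Fin.castAdd n i)) ∈ p.domain ∧
      (fun j => z (Fin.natAdd d j)) ∈ r'.domain})
    (hq'i : Set.EqOn q'.integrand (fun z => p.integrand (fun i => z (Fin.castAdd n i)) *
      r'.integrand (fun j => z (Fin.natAdd d j))) q'.domain)
    (Φ : (Fin (d + n) → ℝ) → (Fin (d + n) → ℝ))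
    (Φ' : (Fin (d + n) → ℝ) → (Fin (d + n) → ℝ) →L[ℝ] (Fin (d + n) → ℝ))
    (hΦ' : ∀ z ∈ q.domain, HasFDerivWithinAt Φ (Φ' z) q.domain z) (hΦinj : Set.InjOn Φ q.domain)
    (himg : q'.domain = Φ '' q.domain)
    (hjac : ∀ z ∈ q.domain, q.integrand z = q'.integrand (Φ z) * |(Φ' z).det|)
    (ψ : (Fin n → ℝ) → (Fin n → ℝ)) (ψ' : (Fin n → ℝ) → (Fin n → ℝ) →L[ℝ] (Fin n → ℝ))
    (hfib : ∀ z ∈ q.domain, (fun j => Φ z (Fin.natAdd d j)) = ψ (fun j => z (Fin.natAdd d j)))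
    (hψ' : ∀ w ∈ r.domain, HasFDerivWithinAt ψ (ψ' w) r.domain w) (hψinj : Set.InjOn ψ r.domain) :
    ∀ᵐ w ∂(MeasureTheory.volume.restrict r.domain),
      r.integrand w = r'.integrand (ψ w) * |(ψ' w).det| := by
  have hKm : MeasurableSet p.domain := IntegralRep.measurableSet_domain_holds p
  have hσm : MeasurableSet r.domain := IntegralRep.measurableSet_domain_holds r
  -- the catalyst domain is non-empty, since `p.value ≠ 0`
  have hKne : p.domain.Nonempty := by
    by_contra h
    apply hp
    rw [not_nonempty_iff_eq_empty] at h
    simp [IntegralRep.value, h]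
  obtain ⟨x₀, hx₀⟩ := hKne
  -- membership in the two pinned product domains
  have hmemq : ∀ z, z ∈ q.domain ↔ (fun i => z (Fin.castAdd n i)) ∈ p.domain ∧
      (fun j => z (Fin.natAdd d j)) ∈ r.domain := fun z => by rw [hq]; rfl
  have hmemq' : ∀ z, z ∈ q'.domain ↔ (fun i => z (Fin.castAdd n i)) ∈ p.domain ∧
      (fun j => z (Fin.natAdd d j)) ∈ r'.domain := fun z => by rw [hq']; rfl
  -- `ψ` maps `σ` into `σ'`: push `(x₀, w)` through `Φ`
  have hψσ : MapsTo ψ r.domain r'.domain := by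
    intro w hw
    have hz : Fin.append x₀ w ∈ q.domain := by
      rw [hmemq]
      simpa using And.intro hx₀ hw
    have hz' : Φ (Fin.append x₀ w) ∈ q'.domain := himg ▸ mem_image_of_mem Φ hz
    rw [hmemq', hfib _ hz] at hz'
    simpa using hz'.2
  -- `ψ` is continuous on `σ`
  have hψc : ContinuousOn ψ r.domain := fun w hw => (hψ' w hw).continuousWithinAt
  -- the identity of integrals over every measurable `A ⊆ σ`
  have key : ∀ A : Set (Fin n → ℝ), MeasurableSet A → A ⊆ r.domain →
      ∫ w in A, r.integrand w = ∫ w in A, |(ψ' w).det| • r'.integrand (ψ w) := by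
    intro A hAm hAσ
    -- the cylinder `S = K × A ⊆ q.domain`
    have hSm : MeasurableSet (appendMeasurableEquiv d n '' (p.domain ×ˢ A)) :=
      fibreAE_measurableSet_image_prod hKm hAm
    have hSq : appendMeasurableEquiv d n '' (p.domain ×ˢ A) ⊆ q.domain := by
      intro z hz
      rw [fibreAE_mem_image_prod] at hz
      rw [hmemq]
      exact ⟨hz.1, hAσ hz.2⟩
    -- the cylinder `S' = K × ψ(A) ⊆ q'.domain`
    have hψAm : MeasurableSet (ψ '' A) :=
      hAm.image_of_continuousOn_injOn (hψc.mono hAσ) (hψinj.mono hAσ)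
    have hψA : ψ '' A ⊆ r'.domain := (image_mono hAσ).trans hψσ.image_subset
    have hS'm : MeasurableSet (appendMeasurableEquiv d n '' (p.domain ×ˢ (ψ '' A))) :=
      fibreAE_measurableSet_image_prod hKm hψAm
    have hS'q : appendMeasurableEquiv d n '' (p.domain ×ˢ (ψ '' A)) ⊆ q'.domain := by
      intro z hz
      rw [fibreAE_mem_image_prod] at hz
      rw [hmemq']
      exact ⟨hz.1, hψA hz.2⟩
    -- `Φ '' S = S'`
    have himS : Φ '' (appendMeasurableEquiv d n '' (p.domain ×ˢ A)) =
        appendMeasurableEquiv d n '' (p.domain ×ˢ (ψ '' A)) := by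
      apply Subset.antisymm
      · rintro _ ⟨z, hz, rfl⟩
        have hzq : z ∈ q.domain := hSq hz
        rw [fibreAE_mem_image_prod] at hz ⊢
        have hΦz : Φ z ∈ q'.domain := himg ▸ mem_image_of_mem Φ hzq
        rw [hmemq'] at hΦz
        refine ⟨hΦz.1, ?_⟩
        rw [hfib z hzq]
        exact mem_image_of_mem ψ hz.2
      · intro z' hz'
        have hz'q : z' ∈ q'.domain := hS'q hz'
        rw [himg] at hz'q
        obtain ⟨z, hzq, rfl⟩ := hz'q
        refine mem_image_of_mem Φ ?_
        rw [fibreAE_mem_image_prod] at hz' ⊢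
        obtain ⟨a, haA, ha⟩ := hz'.2
        rw [hfib z hzq] at ha
        have hz2 := ((hmemq z).1 hzq)
        have haz : a = fun j => z (Fin.natAdd d j) := hψinj (hAσ haA) hz2.2 ha
        exact ⟨hz2.1, haz ▸ haA⟩
    -- Fubini on `S`
    have h1 : ∫ z in appendMeasurableEquiv d n '' (p.domain ×ˢ A), q.integrand z =
        p.value * ∫ w in A, r.integrand w := by
      rw [setIntegral_congr_fun hSm (hqi.mono hSq)]
      exact fibreAE_setIntegral_image_prod_mul _ _ _ _
    -- Fubini on `S'`
    have h2 : ∫ z in appendMeasurableEquiv d n '' (p.domain ×ˢ (ψ '' A)), q'.integrand z =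
        p.value * ∫ w in ψ '' A, r'.integrand w := by
      rw [setIntegral_congr_fun hS'm (hq'i.mono hS'q)]
      exact fibreAE_setIntegral_image_prod_mul _ _ _ _
    -- change of variables for `Φ` on `S`
    have h3 : ∫ z in appendMeasurableEquiv d n '' (p.domain ×ˢ (ψ '' A)), q'.integrand z =
        ∫ z in appendMeasurableEquiv d n '' (p.domain ×ˢ A), q.integrand z := by
      rw [← himS, integral_image_eq_integral_abs_det_fderiv_smul volume hSm
        (fun z hz => (hΦ' z (hSq hz)).mono hSq) (hΦinj.mono hSq)]
      refine setIntegral_congr_fun hSm fun z hz => ?_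
      simp only [smul_eq_mul]
      rw [hjac z (hSq hz), mul_comm]
    -- change of variables for `ψ` on `A`
    have h4 : ∫ w in ψ '' A, r'.integrand w = ∫ w in A, |(ψ' w).det| • r'.integrand (ψ w) :=
      integral_image_eq_integral_abs_det_fderiv_smul volume hAm
        (fun w hw => (hψ' w (hAσ hw)).mono hAσ) (hψinj.mono hAσ) _
    -- assemble and cancel `p.value ≠ 0`
    have h5 : p.value * ∫ w in A, r.integrand w =
        p.value * ∫ w in A, |(ψ' w).det| • r'.integrand (ψ w) := by
      rw [← h1, ← h3, h2, h4]
    exact mul_left_cancel₀ hp h5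
  -- integrability of the right-hand side on `σ`
  have hg : IntegrableOn (fun w => |(ψ' w).det| • r'.integrand (ψ w)) r.domain :=
    (integrableOn_image_iff_integrableOn_abs_det_fderiv_smul volume hσm hψ' hψinj
      r'.integrand).mp (r'.integrableOn.mono_set hψσ.image_subset)
  have hae : r.integrand =ᵐ[volume.restrict r.domain]
      fun w => |(ψ' w).det| • r'.integrand (ψ w) := by
    refine Integrable.ae_eq_of_forall_setIntegral_eq _ _ r.integrableOn.integrable hg.integrable
      fun s hs _ => ?_
    rw [Measure.restrict_restrict hs]
    exact key (s ∩ r.domain) (hs.inter hσm) inter_subset_right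
  filter_upwards [hae] with w hw
  rw [hw, smul_eq_mul, mul_comm]

end Summit.KontsevichZagierPeriods.KontsevichZagierPeriods.BetaCancellationLine

end
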